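import Summits.BirchSwinnertonDyer.BirchSwinnertonDyer.Theses.KolyvaginRankRigidityAtTwo
import Summits.BirchSwinnertonDyer.BirchSwinnertonDyer.Theorems.KolyvaginRankRigidityAtTwoKolyvaginCorankLowerBoundAtTwoRichOfProp37

/-!
# Route `KolyvaginRankRigidityAtTwo`, R5-37: the kernel half of V2♭∞ holds by name

Item `CorankLowerBoundAtTwoRichOfProp37` (stmt-BirchSwinnertonDyer-28229, support child of the print-split of
crux V2♭∞ `KolyvaginCorankLowerBoundAtTwoRich`, stmt-27984): `Prop37FrobeniusCongruenceAtTwo →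
KolyvaginCorankLowerBoundAtTwoRich`, i.e. Gross 1991 Prop. 3.7 (2) ⇒ the rich corank lower bound at `2`.
This is EXACTLY the accepted kernel theorem
`Theorems.KolyvaginLowerBoundAtTwo.KolyvaginCorankLowerBoundAtTwoRich_of_prop37` (LEAD `krr2-p1` g8, p641767:
lossy prime swap from Prop. 3.7 (2) alone, Poitou–Tate as a tree theorem, P4 at `2` unconditional, P5, the hybrid
transverse package, and `krr2-p2`'s `kolyvaginCorankLowerBoundAtTwoRich_of_lossySwap`), re-pointed to the route
decl. THEOREM-ONLY file (no definition, no named fact, no `sorry`). The print fact itself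
(`GrossLMS1991.prop37_2_frobeniusCongruence`, item stmt-23091) is NOT proved here; V2♭∞ is therefore reduced to
print, not closed; BSD is not proved by this. Pen seat `bsd-idea-1` g7.
-/

set_option autoImplicit false
set_option linter.dupNamespace false

namespace Summit.BirchSwinnertonDyer.BirchSwinnertonDyer.Theorems.KolyvaginRigidity

open Summit.BirchSwinnertonDyer.BirchSwinnertonDyer.Theses.KolyvaginRankRigidityAtTwo

/-- **Kernel half of V2♭∞, by name**: Gross 1991 Prop. 3.7 (2) ⇒ `KolyvaginCorankLowerBoundAtTwoRich`
(= p641767 re-pointed to the route item `CorankLowerBoundAtTwoRichOfProp37`). [cite: GrossLMS1991, Prop. 3.7 (2)] -/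
theorem corankLowerBoundAtTwoRichOfProp37_proof : CorankLowerBoundAtTwoRichOfProp37 := fun h =>
  Summit.BirchSwinnertonDyer.BirchSwinnertonDyer.Theorems.KolyvaginLowerBoundAtTwo.KolyvaginCorankLowerBoundAtTwoRich_of_prop37
    h

end Summit.BirchSwinnertonDyer.BirchSwinnertonDyer.Theorems.KolyvaginRigidity
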